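import Literature.Topology.FourManifolds.NullhomotopicNormalFraming
import Literature.Topology.FourManifolds.CodimTwoNormalEuler

/-!
# The tautological section of Kirby's plane field
(registered helper `helper_planeFieldSection` of the stub `stub_normalWitnessTransfer`, line
`cross-cap-laurent`, crux `GromovRecognitionRelEnd`, item stmt-SmoothPoincare4-11009)

Setting: `D : CodimTwoData k X S ℝᵐ` (a compact `k`-manifold `S` immersed in the `(k+2)`-manifold
`X`, read in a Whitney embedding `e : X → ℝᵐ`), a rotation field `J` of its normal planes, a tube
radius `ε`, and radii `0 < δ < δ₀ ≤ ε` such that the tautological normal section `w = D.wVec ε`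
does not vanish at the points of `e(X)` at distance `∈ (0, δ₀)` from the image `f(S)`.  Kirby's
plane field `D.planeField J ε δ z` (`NullhomotopicNormalFraming.lean`) is the family of idempotents
of `ℝᵐ × ℝ²` equal to the normal projection `(p, q) ↦ (Q_{x(z)} p, 0)` within `δ/2` of `f(S)`, to
`(p, q) ↦ (0, q)` beyond `δ`, and on the collar to the projection onto the plane spanned by
`f₀ = (cos θ · w/‖w‖, sin θ · e₀)` and `f₁ = (cos θ · Jw/‖w‖, sin θ · e₁)`, `θ = (π/2) λ(z)`.

Claim (`helper_planeFieldSection`): the **tautological section** of this plane field —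
`(w/‖w‖, 0)` within `δ/2` of `f(S)`, `f₀` on the collar, `(0, e₀)` beyond `δ` — is continuous on
`(e(X) ∖ f(S)) ∪ {dist(·, f(S)) > δ}`, is fixed by the plane field and nowhere zero there, and has
the two displayed normal forms near and far from the image.  This is the section "`s(e) = (e, e)`
… non-zero on `E(ν) - M`", extended by the constant section of the trivial bundle, of R. C. Kirby's
proof of *The Topology of 4-Manifolds*, LNM 1374 (1989), Ch. VIII, Thm. 2, pp. 44–45.

Proof: the pattern of the tree's `CodimTwoData.continuousOn_planeField`: the three pieces are
continuous on their closed domains (`continuousOn_wVec` and `w ≠ 0` on the inner piece off the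
image, `continuousOn_nFrame` and `continuous_collar` on the collar, a constant outside) and agree
on the interfaces (`cos 0 = 1, sin 0 = 0`; `cos (π/2) = 0, sin (π/2) = 1`), glued by
`ContinuousOn.if`; fixedness is `Q w = w` (`Q_wVec`) inside, the computation
`mixOp u c s (c u₀, s e₀) = (c u₀, s e₀)` for an orthonormal pair `u` and `c² + s² = 1` on the
collar (`orthonormal_nFrame`), and `outOp (0, e₀) = (0, e₀)` outside.

Reference: R. C. Kirby, *The Topology of 4-Manifolds*, LNM 1374, Springer (1989), Ch. VIII,
Thm. 2 and its proof, pp. 44–45 [Kirby1989].  No new definitions.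
-/

noncomputable section

open Set Function Metric
open scoped Manifold ContDiff Topology RealInnerProductSpace

-- the prescribed namespace `Summit.<P>.<Sub>.…` duplicates `SmoothPoincare4` (P = Sub)
set_option linter.dupNamespace false

namespace Summit.SmoothPoincare4.SmoothPoincare4.Theorems.GromovRecognitionRelEnd.CrossCapLaurent

namespace PlaneFieldSection

open Literature.Topology.FourManifolds Literature.Topology.FourManifolds.NormalEuler

variable {m : ℕ}

/-- **The first frame vector is fixed by the mixed idempotent**: for an orthonormal pair `u` and
`c² + s² = 1`, `mixOp u c s (c u₀, s e₀) = (c u₀, s e₀)` (the coefficients of `f₀ = (c u₀, s e₀)`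
are `α₀ = c² + s² = 1`, `α₁ = 0`). [folklore] -/
theorem mixOp_frameVec {u : Fin 2 → EuclideanSpace ℝ (Fin m)} (hu : Orthonormal ℝ u) {c s : ℝ}
    (hcs : c ^ 2 + s ^ 2 = 1) :
    mixOp u c s (c • u 0, s • EuclideanSpace.single 0 1) =
      (c • u 0, s • EuclideanSpace.single 0 1) := by
  have h00 : ⟪u 0, u 0⟫ = 1 := by rw [real_inner_self_eq_norm_sq, hu.1 0, one_pow]
  have h10 : ⟪u 1, u 0⟫ = 0 := hu.2 (by decide)
  rw [mixOp_apply, Fin.sum_univ_two]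
  dsimp only
  have h0 : c * ⟪u 0, c • u 0⟫ + s * (s • EuclideanSpace.single 0 (1 : ℝ) :
      EuclideanSpace ℝ (Fin 2)) 0 = 1 := by
    rw [inner_smul_right, h00, PiLp.smul_apply, PiLp.single_apply, if_pos rfl, smul_eq_mul]
    linear_combination hcs
  have h1 : c * ⟪u 1, c • u 0⟫ + s * (s • EuclideanSpace.single 0 (1 : ℝ) :
      EuclideanSpace ℝ (Fin 2)) 1 = 0 := by
    rw [inner_smul_right, h10, PiLp.smul_apply, PiLp.single_apply,
      if_neg (by decide), smul_eq_mul]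
    ring
  rw [h0, h1, one_smul, zero_smul, add_zero]

/-- The first frame vector `(c u₀, s e₀)` is nonzero (`‖u₀‖ = 1`, `c² + s² = 1`). [folklore] -/
theorem frameVec_ne_zero {u : Fin 2 → EuclideanSpace ℝ (Fin m)} (hu0 : ‖u 0‖ = 1) {c s : ℝ}
    (hcs : c ^ 2 + s ^ 2 = 1) :
    ((c • u 0, s • EuclideanSpace.single 0 1) :
      EuclideanSpace ℝ (Fin m) × EuclideanSpace ℝ (Fin 2)) ≠ 0 := by
  intro h
  obtain ⟨h1, h2⟩ := Prod.mk_eq_zero.1 h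
  have hc : c = 0 := by
    have := congrArg norm h1
    rw [norm_smul, hu0, mul_one, norm_zero, Real.norm_eq_abs] at this
    exact abs_eq_zero.1 this
  have hs : s = 0 := by
    have := congrArg norm h2
    rw [norm_smul, norm_zero, Real.norm_eq_abs] at this
    simp only [PiLp.norm_single, norm_one, mul_one] at this
    exact abs_eq_zero.1 this
  rw [hc, hs] at hcs
  norm_num at hcs

/-- The constant outer vector `(0, e₀)` is nonzero. [folklore] -/
theorem outVec_ne_zero :
    ((0, EuclideanSpace.single 0 1) : EuclideanSpace ℝ (Fin m) × EuclideanSpace ℝ (Fin 2)) ≠ 0 := by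
  intro h
  have := (Prod.mk_eq_zero.1 h).2
  simp at this

end PlaneFieldSection

open Literature.Topology.FourManifolds Literature.Topology.FourManifolds.NormalEuler
  Literature.Topology.FourManifolds.CodimTwoData in
/-- **Registered helper `helper_planeFieldSection`: the tautological section of Kirby's plane
field.** For `D : CodimTwoData k X S ℝᵐ`, a rotation field `J`, a tube radius `ε` and radii
`0 < δ < δ₀ ≤ ε` with `w = D.wVec ε ≠ 0` at the points of `e(X)` at distance `∈ (0, δ₀)` from
`f(S)`, the section `sec` equal to `(w/‖w‖, 0)` within `δ/2` of `f(S)`, to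
`(cos θ · w/‖w‖, sin θ · e₀)` (`θ = (π/2) λ(z)`) on the collar `δ/2 < dist ≤ δ`, and to `(0, e₀)`
beyond `δ` is continuous on `(e(X) ∖ f(S)) ∪ {dist > δ}`, fixed by `D.planeField J ε δ` and
nowhere zero there (pattern of `continuousOn_planeField`; `Q w = w`, `mixOp f₀ = f₀`,
`outOp (0, e₀) = (0, e₀)`). [cite: Kirby1989, Ch. VIII, proof of Thm. 2, pp. 44–45] -/
theorem helper_planeFieldSection : ∀ (k m : ℕ) (X : Type) [TopologicalSpace X] [ChartedSpace (EuclideanSpace ℝ (Fin (k + 2))) X] [IsManifold (𝓡 (k + 2)) ∞ X] (S : Type) [TopologicalSpace S] [ChartedSpace (EuclideanSpace ℝ (Fin k)) S] [IsManifold (𝓡 k) ∞ S] [CompactSpace S] [Nonempty S] (D : Literature.Topology.FourManifolds.CodimTwoData k X S (EuclideanSpace ℝ (Fin m))) (J : S → EuclideanSpace ℝ (Fin m) →L[ℝ] EuclideanSpace ℝ (Fin m)) (ε δ δ₀ : ℝ), D.IsRotationField J → D.IsTubeRadius ε → 0 < δ → δ < δ₀ → δ₀ ≤ ε → (∀ q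 : X, 0 < Metric.infDist (D.e q) D.img → Metric.infDist (D.e q) D.img < δ₀ → D.wVec ε (D.e q) ≠ 0) → ∃ sec : EuclideanSpace ℝ (Fin m) → EuclideanSpace ℝ (Fin m) × EuclideanSpace ℝ (Fin 2), ContinuousOn sec ((Set.range D.e \ D.img) ∪ {z | δ < Metric.infDist z D.img}) ∧ (∀ z ∈ (Set.range D.e \ D.img) ∪ {z | δ < Metric.infDist z D.img}, D.planeField J ε δ z (sec z) = sec z ∧ sec z ≠ 0) ∧ (∀ z, Metric.infDist z D.img ≤ δ / 2 → sec z = (‖D.wVec ε z‖⁻¹ • D.wVec ε z, 0)) ∧ (∀ z, δ < Metric.infDist z D.img → sec z = (0, EuclideanSpace.single 0 1)) := by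
  intro k m X _ _ _ S _ _ _ _ _ D J ε δ δ₀ hJ hε hδ hδδ₀ hδ₀ε hw0
  have hρ : Continuous fun z : EuclideanSpace ℝ (Fin m) => infDist z D.img :=
    continuous_infDist_pt _
  -- a point of the domain within `δ` of the image is a point of `e(X)` off the (closed) image
  have hUmem : ∀ z ∈ (range D.e \ D.img) ∪ {z | δ < infDist z D.img}, infDist z D.img ≤ δ →
      0 < infDist z D.img ∧ z ∈ range D.e := by
    rintro z (⟨hzr, hzi⟩ | hz) hzδ
    · exact ⟨D.infDist_pos_of_notMem hzi, hzr⟩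
    · exact absurd hzδ (not_le.2 hz)
  -- hence the tautological section does not vanish there
  have hwU : ∀ z ∈ (range D.e \ D.img) ∪ {z | δ < infDist z D.img}, infDist z D.img ≤ δ →
      D.wVec ε z ≠ 0 := by
    intro z hz hzδ
    obtain ⟨h0, q, rfl⟩ := hUmem z hz hzδ
    exact hw0 q h0 (hzδ.trans_lt hδδ₀)
  obtain ⟨sec, hsec⟩ : ∃ sec : EuclideanSpace ℝ (Fin m) →
      EuclideanSpace ℝ (Fin m) × EuclideanSpace ℝ (Fin 2), sec = fun z =>
        if infDist z D.img ≤ δ / 2 then (‖D.wVec ε z‖⁻¹ • D.wVec ε z, 0)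
        else if infDist z D.img ≤ δ then
          (Real.cos (Real.pi / 2 * D.collar δ z) • D.nFrame J ε z 0,
            Real.sin (Real.pi / 2 * D.collar δ z) • EuclideanSpace.single 0 1)
        else (0, EuclideanSpace.single 0 1) := ⟨_, rfl⟩
  refine ⟨sec, ?_, ?_, ?_, ?_⟩
  · -- (a) continuity on the domain: three pieces glued on the interfaces
    -- piece 1 on `{dist ≤ δ/2}`
    have h1 : ContinuousOn (fun z => ((‖D.wVec ε z‖⁻¹ • D.wVec ε z, 0) :
        EuclideanSpace ℝ (Fin m) × EuclideanSpace ℝ (Fin 2)))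
        (((range D.e \ D.img) ∪ {z | δ < infDist z D.img}) ∩
          closure {z | infDist z D.img ≤ δ / 2}) := by
      rw [(isClosed_le hρ continuous_const).closure_eq]
      have hsub : ((range D.e \ D.img) ∪ {z | δ < infDist z D.img}) ∩
          {z | infDist z D.img ≤ δ / 2} ⊆ {z | infDist z D.img < ε} := by
        rintro z ⟨-, hz⟩
        exact lt_of_le_of_lt (show infDist z D.img ≤ δ / 2 from hz) (by linarith)
      have hw := (D.continuousOn_wVec hε).mono hsub
      have hn : ContinuousOn (fun z => ‖D.wVec ε z‖⁻¹)
          (((range D.e \ D.img) ∪ {z | δ < infDist z D.img}) ∩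
            {z | infDist z D.img ≤ δ / 2}) :=
        hw.norm.inv₀ fun z hz => norm_ne_zero_iff.2
          (hwU z hz.1 ((show infDist z D.img ≤ δ / 2 from hz.2).trans (by linarith)))
      exact (hn.smul hw).prodMk continuousOn_const
    -- piece 2 on the collar set
    have h2 : ContinuousOn (fun z => ((Real.cos (Real.pi / 2 * D.collar δ z) • D.nFrame J ε z 0,
          Real.sin (Real.pi / 2 * D.collar δ z) • EuclideanSpace.single 0 1) :
        EuclideanSpace ℝ (Fin m) × EuclideanSpace ℝ (Fin 2)))
        {z | infDist z D.img ≤ δ ∧ 0 < infDist z D.img ∧ z ∈ range D.e} := by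
      have hc := continuous_collar (D := D) δ
      have hcos : Continuous fun z => Real.cos (Real.pi / 2 * D.collar δ z) :=
        Real.continuous_cos.comp (continuous_const.mul hc)
      have hsin : Continuous fun z => Real.sin (Real.pi / 2 * D.collar δ z) :=
        Real.continuous_sin.comp (continuous_const.mul hc)
      have hnF0 : ContinuousOn (fun z => D.nFrame J ε z 0)
          {z | infDist z D.img ≤ δ ∧ 0 < infDist z D.img ∧ z ∈ range D.e} :=
        continuousOn_pi.1 (continuousOn_nFrame hJ hε hδδ₀ hδ₀ε hw0) 0
      exact (hcos.continuousOn.smul hnF0).prodMk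
        (hsin.smul continuous_const).continuousOn
    -- pieces 2 and 3 on `{δ/2 ≤ dist}`
    have h23 : ContinuousOn (fun z => if infDist z D.img ≤ δ then
        ((Real.cos (Real.pi / 2 * D.collar δ z) • D.nFrame J ε z 0,
          Real.sin (Real.pi / 2 * D.collar δ z) • EuclideanSpace.single 0 1) :
          EuclideanSpace ℝ (Fin m) × EuclideanSpace ℝ (Fin 2))
        else (0, EuclideanSpace.single 0 1))
        (((range D.e \ D.img) ∪ {z | δ < infDist z D.img}) ∩
          closure {z | ¬infDist z D.img ≤ δ / 2}) := by
      refine ContinuousOn.if ?_ ?_ continuousOn_const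
      · -- interface `dist = δ`
        rintro z ⟨-, hz⟩
        have hzδ : infDist z D.img = δ := frontier_le_subset_eq hρ continuous_const hz
        have hlam : D.collar δ z = 1 := by
          rw [CodimTwoData.collar, hzδ]; field_simp; ring
        rw [hlam, mul_one, Real.cos_pi_div_two, Real.sin_pi_div_two, zero_smul, one_smul]
      · refine h2.mono ?_
        rintro z ⟨⟨hz1, -⟩, hz3⟩
        rw [(isClosed_le hρ continuous_const).closure_eq] at hz3
        have hz3' : infDist z D.img ≤ δ := hz3
        exact ⟨hz3', hUmem z hz1 hz3'⟩
    -- assemble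
    rw [hsec]
    refine ContinuousOn.if ?_ h1 h23
    -- interface `dist = δ/2`
    rintro z ⟨-, hfr⟩
    have hzδ : infDist z D.img = δ / 2 := frontier_le_subset_eq hρ continuous_const hfr
    rw [if_pos (by linarith)]
    have hlam : D.collar δ z = 0 := by
      rw [CodimTwoData.collar, hzδ]; field_simp; ring
    simp only [hlam, mul_zero, Real.cos_zero, Real.sin_zero, one_smul, zero_smul]
    rfl
  · -- (b) fixed by the plane field and nowhere zero on the domain
    intro z hz
    simp only [hsec]
    unfold CodimTwoData.planeField
    split_ifs with h1 h2
    · have hw : D.wVec ε z ≠ 0 := hwU z hz (h1.trans (by linarith))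
      refine ⟨?_, fun h => ?_⟩
      · rw [inOp_apply]
        dsimp only
        rw [ContinuousLinearMap.map_smul, D.Q_wVec]
      · have := (Prod.mk_eq_zero.1 h).1
        rw [smul_eq_zero, inv_eq_zero, norm_eq_zero, or_self] at this
        exact hw this
    · have hw : D.wVec ε z ≠ 0 := hwU z hz h2
      have hcs := Real.cos_sq_add_sin_sq (Real.pi / 2 * D.collar δ z)
      exact ⟨PlaneFieldSection.mixOp_frameVec (orthonormal_nFrame hJ hw) hcs,
        PlaneFieldSection.frameVec_ne_zero ((orthonormal_nFrame hJ hw).1 0) hcs⟩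
    · exact ⟨rfl, PlaneFieldSection.outVec_ne_zero⟩
  · -- (c) the normal form near the image
    intro z hz
    simp only [hsec]
    rw [if_pos hz]
  · -- (d) the normal form far from the image
    intro z hz
    have h1 : ¬infDist z D.img ≤ δ / 2 := not_le.2 (by linarith)
    have h2 : ¬infDist z D.img ≤ δ := not_le.2 hz
    simp only [hsec]
    rw [if_neg h1, if_neg h2]

end Summit.SmoothPoincare4.SmoothPoincare4.Theorems.GromovRecognitionRelEnd.CrossCapLaurent
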